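import Summits.Ventures.CertifiedManyBodySolver.Observables.PhaseSeparationExclusionParticleHoleColumns
import Summits.Ventures.CertifiedManyBodySolver.Observables.PhaseSeparationExclusionBoxGrandCanonicalTcap
import Summits.Ventures.CertifiedManyBodySolver.Observables.PhaseSeparationExclusionBoxZeemanTcap
import Summits.Ventures.CertifiedManyBodySolver.Observables.PhaseSeparationExclusionBoxLayeredTcap
import HarnessLib

/-!
# Ventures/CertifiedManyBodySolver — Observables/PhaseSeparationExclusionParticleHoleThermalAxes.lean: the particle–hole transport of the competing-order
# words, PART 5 — the `T > 0` AXES: the `μ`-axis («no `(β, μ)` carries both»), the FIELD-axis and the LAYERED-crystal column × threshold laws REFLECTED to the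
# electron-doped side (same hypotheses as the hole-side column laws; conclusion on the mirrored cell)

HONEST FRAMING: first certified bounds; not a superconductivity verdict. CLASS = TRANSPORT (generic, sorry-free; no claim node, no number, no definition). Companion of
`PhaseSeparationExclusionParticleHole{,Columns,Zeeman,Layered}.lean` (g28). Under `(t′, n) ↦ (−t′, 2 − n)` the 2D bundle — cap, floors, pressure anchors — transports with the
affine terms of `energyDensityTT'_particleHole` / `pressureTT'_particleHole` (`reflected_cap/floor/anchor`); the `T = 0` margin, the anchored combination, the field cost
(`n₂ ≤ 1`: `b·min(2−n₂, n₂) + a·min(2−n₁, n₁) = an₁ + bn₂`) and the density-independent interlayer cost are INVARIANT, so every threshold `β₀`, `h₀`, `k` is the hole-side one: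
* `psGCT_not_equilibrium_on_cell_of_columns_hotAnchorSS_tcap_reflected` — `μ` axis, `T > 0`: on the mirrored cell, at `β ≥ β₀`, no `μ` carries a variational equilibrium of
  `H(t,s,U) − μN` of density `≤ 2 − n₂` together with one of density `≥ 2 − n₁` (through `psGCT_not_equilibrium_on_cell_of_fns_hotAnchorFn_reflected` + `anchored_lt_of_columns_hotAnchorSS_tcap`).
* `psHT_not_fieldEquilibrium_mix_on_cell_of_columns_hotAnchorSS_tcap_reflected` — `H` axis, `T > 0` (`n₂ ≤ 1` on the hole side): on the mirrored cell no mixture of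
  translation-invariant states with densities `≤ 2 − n₂`, `≥ 2 − n₁` is a canonical field equilibrium state of `Φ(t,s,U) − h(n↑ − n↓)` at `β ≥ β₀`, every `|h| ≤ h₀` (law
  `sub_mul_field_lt_pressureTT'Zeeman_mix_of_hotAnchors_of_le`, general `min` cost).
* `psLT_not_layeredEquilibrium_mix_on_cell_of_columns_hotAnchorSS_tcap_reflected` — `c` axis, `T > 0`: on the mirrored cell no such mixture on `ℤ³` is a canonical equilibrium
  state of `layeredHubbardTTPrime t s U w tz` at `β ≥ β₀` for every stacking with `(4/π)Σ|t_z| ≤ k` (law `sub_mul_layered_lt_varPressureAt_mix_of_hotAnchors_of_threshold_of_cost_le`).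
Instances: `Observables/PhaseSeparationExclusionElectronDopedMirrorThermalAxes.lean`. Cell `pub/hubbard-downfold` (MO-S1 ↔ S2 seam, filling direction; D-0096 (ii)+(iii),
D-0098/D-0100 axes), seat `hubbard-downfold-unc-2` (g28), 2026-08-29. Zero kit. References: [cite: LiebWuPhysicaA2003, §1 eq. (3)]; [cite: Israel1979, Thm. I.2.4];
[cite: PoulinHastings2011, eqs. (3)–(8)]; [cite: Griffiths1964, Appendix]; [cite: BratteliKishimotoRobinson1978, Thm. 2]; [cite: Ruelle1969, §3.4].
-/

noncomputable section

namespace Summit.Ventures.CertifiedManyBodySolver.Observables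

open Literature.MathematicalPhysics.QuantumLattice Literature.MathematicalPhysics.QuantumLattice.ThermodynamicLimit
open Literature.MathematicalPhysics.QuantumLattice.InfVolFermionState Set Filter
open Literature.Probability.LatticeModels HubbardWave0
open scoped BigOperators

/-! ## §1 `μ` axis, `T > 0` -/

/-- **NO `(β, μ)` CARRIES BOTH PHASES ON THE MIRRORED CELL, COLUMN × THRESHOLD FORM.** Hypotheses EXACTLY as
`psGCT_not_equilibrium_on_cell_of_columns_hotAnchorSS_tcap` (source cell `[s₁, s₂] × [U₁, U₂]`, `0 < n₁ < n₂ < 2`, cap `c₀ + c_s s + c₁ U`, column laws at `n₂`, dilute floor,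
anchors `Q₁(s), Q₂(s)`, both column margins `≥ 0`, anchored inequality at `β₀` on both columns, `β_{h,i} ≤ β₀ ≤ β`); CONCLUSION: at every `(s, U)` of `[−s₂, −s₁] × [U₁, U₂]` and every
`μ`, if `H(t,s,U) − μN` (any `Γ` with `e_Γ = e_Φ − μρ`) has a variational equilibrium at `β` of density `≤ 2 − n₂`, it has none of density `≥ 2 − n₁`.
[cite: LiebWuPhysicaA2003, §1 eq. (3)] [cite: Israel1979, Thm. I.2.4] [cite: PoulinHastings2011, eqs. (3)–(8)] [cite: Ruelle1969, §3.4] -/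
theorem psGCT_not_equilibrium_on_cell_of_columns_hotAnchorSS_tcap_reflected (t : ℝ) {s₁ s₂ U₁ U₂ n₁ n₂ a b c₀ cs c₁ β β₀ βh₁ βh₂ : ℝ}
    (hU₁ : 0 ≤ U₁) (h12 : U₁ < U₂) (hn₁ : 0 < n₁) (hn : n₁ < n₂) (hn₂ : n₂ < 2) (ha : 0 ≤ a) (hb : 0 ≤ b)
    (hab : a + b = 1) (hβh₁ : 0 ≤ βh₁) (hβh₂ : 0 ≤ βh₂) (h0₁ : βh₁ ≤ β₀) (h0₂ : βh₂ ≤ β₀) (hβ₀ : β₀ ≤ β)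
    (hβ₀pos : 0 < β₀) {L₁ L₂ F₁ Q₁ Q₂ : ℝ → ℝ}
    (hC : ∀ s ∈ Icc s₁ s₂, ∀ U ∈ Icc U₁ U₂, energyDensityTT' t s U (a * n₁ + b * n₂) ≤ c₀ + cs * s + c₁ * U)
    (hL₁ : ∀ s ∈ Icc s₁ s₂, L₁ s ≤ energyDensityTT' t s U₁ n₂) (hL₂ : ∀ s ∈ Icc s₁ s₂, L₂ s ≤ energyDensityTT' t s U₂ n₂)
    (hF₁ : ∀ s ∈ Icc s₁ s₂, ∀ U ∈ Icc U₁ U₂, F₁ s ≤ energyDensityTT' t s U n₁)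
    (hπ₁ : ∀ s ∈ Icc s₁ s₂, ∀ U ∈ Icc U₁ U₂, pressureTT' βh₁ t s U n₁ ≤ Q₁ s)
    (hπ₂ : ∀ s ∈ Icc s₁ s₂, ∀ U ∈ Icc U₁ U₂, pressureTT' βh₂ t s U n₂ ≤ Q₂ s)
    (hm₁ : ∀ s ∈ Icc s₁ s₂, 0 ≤ a * F₁ s + b * L₁ s - (c₀ + cs * s + c₁ * U₁))
    (hm₂ : ∀ s ∈ Icc s₁ s₂, 0 ≤ a * F₁ s + b * L₂ s - (c₀ + cs * s + c₁ * U₂))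
    (hg₁ : ∀ s ∈ Icc s₁ s₂,
      a * Q₁ s + b * Q₂ s + βh₁ * (a * F₁ s) + βh₂ * (b * L₁ s) < β₀ * (a * F₁ s + b * L₁ s - (c₀ + cs * s + c₁ * U₁)))
    (hg₂ : ∀ s ∈ Icc s₁ s₂,
      a * Q₁ s + b * Q₂ s + βh₁ * (a * F₁ s) + βh₂ * (b * L₂ s) < β₀ * (a * F₁ s + b * L₂ s - (c₀ + cs * s + c₁ * U₂)))
    {s : ℝ} (hs : s ∈ Icc (-s₂) (-s₁)) {U : ℝ} (hU : U ∈ Icc U₁ U₂)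
    {Γ : FermionInteraction 2} {R' μ : ℝ} {ω₁ ω₂ : InfVolFermionState 2} (hω₁ : ω₁.IsVarEquilibrium β Γ R')
    (hΓ : ∀ σ : InfVolFermionState 2, σ.meanEnergy Γ R' = σ.meanEnergy (hubbardTTPrimeFermionInteraction t s U) 1 - μ * σ.density)
    (hρ₁ : ω₁.density ≤ 2 - n₂) (hρ₂ : 2 - n₁ ≤ ω₂.density) :
    ¬ ω₂.IsVarEquilibrium β Γ R' := by
  have hn2' : 0 ≤ n₂ := hn₁.le.trans hn.le
  have hβpos : 0 < β := hβ₀pos.trans_le hβ₀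
  exact psGCT_not_equilibrium_on_cell_of_fns_hotAnchorFn_reflected t hU₁ hβpos hn₁ hn hn₂ ha hb hab hβh₁ hβh₂ (h0₁.trans hβ₀)
    (h0₂.trans hβ₀) (C := fun s U => c₀ + cs * s + c₁ * U) (F₁ := fun s _ => F₁ s)
    (F₂ := fun s U => ((U₂ - U) * L₁ s + (U - U₁) * L₂ s) / (U₂ - U₁)) (P₁ := fun s _ => Q₁ s) (P₂ := fun s _ => Q₂ s) hC hF₁
    (floor_on_cell_of_columnLaws t hn2' hn₂ hU₁ h12 hL₁ hL₂) hπ₁ hπ₂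
    (anchored_lt_of_columns_hotAnchorSS_tcap h12 hβ₀ hm₁ hm₂ hg₁ hg₂) hs hU hω₁ hΓ hρ₁ hρ₂

/-! ## §2 `H` axis, `T > 0` -/

/-- **FIELD THERMAL PS EXCLUSION ON THE MIRRORED CELL, COLUMN × THRESHOLD FORM.** Hypotheses EXACTLY as
`psHT_not_fieldEquilibrium_mix_on_cell_of_columns_hotAnchorSS_tcap` with `0 < n₁` (source cell, `n₁ < n₂ ≤ 1`; zero-field cap / column laws / dilute floor; anchors `Q₁(s), Q₂(s)`,
`0 ≤ β_{h,i} ≤ β₀ ≤ β`; `|h| ≤ h₀`; both column margins AFTER the field cost `h₀·(an₁ + bn₂)` `≥ 0` and the anchored inequality at `β₀` with that cost on both columns). CONCLUSION: at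
every `(s, U)` of the MIRRORED cell `[−s₂, −s₁] × [U₁, U₂]`, no mixture `λω₁ + (1−λ)ω₂` of translation-invariant states with `0 < ρ(ω₁) ≤ 2 − n₂`, `2 − n₁ ≤ ρ(ω₂) < 2` is a canonical
field equilibrium state of `Φ(t,s,U) − h·(n↑ − n↓)` at `β` (`s̄ − β(e_Φ − h m) < p_h(β; ρ)`): the field cost of the mirrored pair is the hole-side number.
[cite: LiebWuPhysicaA2003, §1 eq. (3)] [cite: Israel1979, Thm. I.2.4] [cite: Griffiths1964, Appendix] [cite: PoulinHastings2011, eqs. (3)–(8)] -/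
theorem psHT_not_fieldEquilibrium_mix_on_cell_of_columns_hotAnchorSS_tcap_reflected (t : ℝ)
    {s₁ s₂ U₁ U₂ n₁ n₂ a b c₀ cs c₁ β β₀ βh₁ βh₂ h₀ hz : ℝ}
    (hU₁ : 0 ≤ U₁) (h12 : U₁ < U₂) (hn₁ : 0 < n₁) (hn : n₁ < n₂) (hn₂ : n₂ ≤ 1) (ha : 0 ≤ a) (hb : 0 ≤ b)
    (hab : a + b = 1) (hβh₁ : 0 ≤ βh₁) (hβh₂ : 0 ≤ βh₂) (h0₁ : βh₁ ≤ β₀) (h0₂ : βh₂ ≤ β₀) (hβ₀ : β₀ ≤ β)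
    (hβ₀pos : 0 < β₀) {L₁ L₂ F₁ Q₁ Q₂ : ℝ → ℝ}
    (hC : ∀ s ∈ Icc s₁ s₂, ∀ U ∈ Icc U₁ U₂, energyDensityTT' t s U (a * n₁ + b * n₂) ≤ c₀ + cs * s + c₁ * U)
    (hL₁ : ∀ s ∈ Icc s₁ s₂, L₁ s ≤ energyDensityTT' t s U₁ n₂) (hL₂ : ∀ s ∈ Icc s₁ s₂, L₂ s ≤ energyDensityTT' t s U₂ n₂)
    (hF₁ : ∀ s ∈ Icc s₁ s₂, ∀ U ∈ Icc U₁ U₂, F₁ s ≤ energyDensityTT' t s U n₁)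
    (hπ₁ : ∀ s ∈ Icc s₁ s₂, ∀ U ∈ Icc U₁ U₂, pressureTT' βh₁ t s U n₁ ≤ Q₁ s)
    (hπ₂ : ∀ s ∈ Icc s₁ s₂, ∀ U ∈ Icc U₁ U₂, pressureTT' βh₂ t s U n₂ ≤ Q₂ s)
    (hh : |hz| ≤ h₀)
    (hm₁ : ∀ s ∈ Icc s₁ s₂, 0 ≤ a * F₁ s + b * L₁ s - (c₀ + cs * s + c₁ * U₁) - h₀ * (a * n₁ + b * n₂))
    (hm₂ : ∀ s ∈ Icc s₁ s₂, 0 ≤ a * F₁ s + b * L₂ s - (c₀ + cs * s + c₁ * U₂) - h₀ * (a * n₁ + b * n₂))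
    (hg₁ : ∀ s ∈ Icc s₁ s₂, a * Q₁ s + b * Q₂ s + βh₁ * (a * F₁ s) + βh₂ * (b * L₁ s) <
      β₀ * (a * F₁ s + b * L₁ s - (c₀ + cs * s + c₁ * U₁) - h₀ * (a * n₁ + b * n₂)))
    (hg₂ : ∀ s ∈ Icc s₁ s₂, a * Q₁ s + b * Q₂ s + βh₁ * (a * F₁ s) + βh₂ * (b * L₂ s) <
      β₀ * (a * F₁ s + b * L₂ s - (c₀ + cs * s + c₁ * U₂) - h₀ * (a * n₁ + b * n₂)))
    {s : ℝ} (hs : s ∈ Icc (-s₂) (-s₁)) {U : ℝ} (hU : U ∈ Icc U₁ U₂)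
    {ω₁ ω₂ : InfVolFermionState 2} (h₁ : ω₁.IsTranslationInvariant) (h₂ : ω₂.IsTranslationInvariant)
    (hρ₁ : 0 < ω₁.density) (hρ₁' : ω₁.density ≤ 2 - n₂) (hρ₂ : 2 - n₁ ≤ ω₂.density) (hρ₂' : ω₂.density < 2)
    {lam : ℝ} (hl0 : 0 < lam) (hl1 : lam < 1) :
    (mix lam hl0.le hl1.le ω₁ ω₂).entropyDensitySup -
        β * (mix lam hl0.le hl1.le ω₁ ω₂).meanEnergy (gcInteractionTT' t s U 0 hz) 1 <
      pressureTT'Zeeman β t s U (mix lam hl0.le hl1.le ω₁ ω₂).density hz := by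
  have hn2' : 0 ≤ n₂ := hn₁.le.trans hn.le
  have hn₂2 : n₂ < 2 := by linarith
  have hm0 : 0 < a * n₁ + b * n₂ := by nlinarith
  have hm2 : a * n₁ + b * n₂ < 2 := by nlinarith
  have hβpos : 0 < β := hβ₀pos.trans_le hβ₀
  have hs' : -s ∈ Icc s₁ s₂ := neg_mem_Icc_of_mem_Icc_neg hs
  have hUU : 0 ≤ U := hU₁.trans hU.1
  -- the reflected bundle at the target point `(s, U)`
  have hcap : energyDensityTT' t s U (b * (2 - n₂) + a * (2 - n₁)) ≤
      c₀ + cs * (-s) + c₁ * U + U * (b * (2 - n₂) + a * (2 - n₁) - 1) :=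
    reflected_cap t hU₁ hab hm0 hm2 (C := fun s U => c₀ + cs * s + c₁ * U) hC s hs U hU
  have hfl₂ : ((U₂ - U) * L₁ (-s) + (U - U₁) * L₂ (-s)) / (U₂ - U₁) + U * (1 - n₂) ≤ energyDensityTT' t s U (2 - n₂) :=
    reflected_floor t hU₁ (hn₁.trans hn) hn₂2 (F := fun s U => ((U₂ - U) * L₁ s + (U - U₁) * L₂ s) / (U₂ - U₁))
      (floor_on_cell_of_columnLaws t hn2' hn₂2 hU₁ h12 hL₁ hL₂) s hs U hU
  have hfl₁ : F₁ (-s) + U * (1 - n₁) ≤ energyDensityTT' t s U (2 - n₁) :=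
    reflected_floor t hU₁ hn₁ (hn.trans hn₂2) (F := fun s _ => F₁ s) hF₁ s hs U hU
  have han₂ : pressureTT' βh₂ t s U (2 - n₂) ≤ Q₂ (-s) + βh₂ * U * (n₂ - 1) :=
    reflected_anchor t hβh₂ hU₁ (hn₁.trans hn) hn₂2 (P := fun s _ => Q₂ s) hπ₂ s hs U hU
  have han₁ : pressureTT' βh₁ t s U (2 - n₁) ≤ Q₁ (-s) + βh₁ * U * (n₁ - 1) :=
    reflected_anchor t hβh₁ hU₁ hn₁ (hn.trans hn₂2) (P := fun s _ => Q₁ s) hπ₁ s hs U hU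
  -- the source slack at `(-s, U)` (U-chord of the two column slacks)
  obtain ⟨hMnn, hM₀⟩ := hotAnchor_chord_slack (c₀ := c₀ + cs * (-s)) (βh₁ := βh₁) (βh₂ := βh₂) (π₁ := Q₁ (-s))
    (π₂ := Q₂ (-s)) h12 hU (hm₁ (-s) hs') (hm₂ (-s) hs') (hg₁ (-s) hs') (hg₂ (-s) hs')
  refine h₁.sub_mul_field_lt_pressureTT'Zeeman_mix_of_hotAnchors_of_le t s hUU hβpos hz h₂ hρ₁ hρ₂' hρ₁' (by linarith) hρ₂ hb ha
    (by linarith) hcap hfl₂ hfl₁ hβh₂ hβh₁ (h0₂.trans hβ₀) (h0₁.trans hβ₀) han₂ han₁ ?_ hl0 hl1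
  -- the field cost of the mirrored pair is the hole-side number
  have e₁ : min (2 - n₂) (2 - (2 - n₂)) = n₂ := by rw [sub_sub_cancel]; exact min_eq_right (by linarith)
  have e₂ : min (2 - n₁) (2 - (2 - n₁)) = n₁ := by rw [sub_sub_cancel]; exact min_eq_right (by linarith)
  rw [e₁, e₂]
  have k1 := mul_le_mul_of_nonneg_right hβ₀ hMnn
  have k2 : β * (h₀ * (a * n₁ + b * n₂)) ≥ β * (|hz| * (b * n₂ + a * n₁)) := by
    have := mul_le_mul_of_nonneg_right hh hm0.le
    exact mul_le_mul_of_nonneg_left (by linarith) hβpos.le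
  have hb1 : b = 1 - a := by linarith
  subst hb1
  linarith

/-! ## §3 `c` axis, `T > 0` -/

/-- **LAYERED-CRYSTAL THERMAL PS EXCLUSION ON THE MIRRORED CELL, COLUMN × THRESHOLD FORM.** Hypotheses EXACTLY as
`psLT_not_layeredEquilibrium_mix_on_cell_of_columns_hotAnchorSS_tcap` with `0 < n₁` (stacking `w, tz` with `(4/π)Σ|t_z| ≤ k`; source cell of 2D data; anchors; both column
margins after the cost `≥ 0` and the anchored inequality at `β₀` on both columns). CONCLUSION: at every `(s, U)` of the MIRRORED cell `[−s₂, −s₁] × [U₁, U₂]`, no mixture of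
translation-invariant states on `ℤ³` with `0 < ρ(ω₁) ≤ 2 − n₂`, `2 − n₁ ≤ ρ(ω₂) < 2` is a canonical equilibrium state of `layeredHubbardTTPrime t s U w tz` at `β ≥ β₀`
(`s̄ − β e < P(β; ρ)`) — the cost is density independent. [cite: LiebWuPhysicaA2003, §1 eq. (3)] [cite: Israel1979, Thm. I.2.4] [cite: BratteliKishimotoRobinson1978, Thm. 2 (condition 2)] [cite: PoulinHastings2011, eqs. (3)–(8)] -/
theorem psLT_not_layeredEquilibrium_mix_on_cell_of_columns_hotAnchorSS_tcap_reflected (t : ℝ) {κ : Type*} [Fintype κ]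
    {w : κ → Site 3} (hw : ∀ b, w b 0 ≠ 0) (tz : κ → ℝ) {R' : ℝ} (hR' : 1 ≤ R') (hwR' : ∀ b, w b ∈ thicken ({0} : Finset (Site 3)) R')
    {s₁ s₂ U₁ U₂ n₁ n₂ a b c₀ cs c₁ β β₀ βh₁ βh₂ k : ℝ}
    (hU₁ : 0 ≤ U₁) (h12 : U₁ < U₂) (hn₁ : 0 < n₁) (hn : n₁ < n₂) (hn₂ : n₂ < 2) (ha : 0 ≤ a) (hb : 0 ≤ b)
    (hab : a + b = 1) (hβh₁ : 0 ≤ βh₁) (hβh₂ : 0 ≤ βh₂) (h0₁ : βh₁ ≤ β₀) (h0₂ : βh₂ ≤ β₀) (hβ₀ : β₀ ≤ β)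
    (hβ₀pos : 0 < β₀) {L₁ L₂ F₁ Q₁ Q₂ : ℝ → ℝ}
    (hC : ∀ s ∈ Icc s₁ s₂, ∀ U ∈ Icc U₁ U₂, energyDensityTT' t s U (a * n₁ + b * n₂) ≤ c₀ + cs * s + c₁ * U)
    (hL₁ : ∀ s ∈ Icc s₁ s₂, L₁ s ≤ energyDensityTT' t s U₁ n₂) (hL₂ : ∀ s ∈ Icc s₁ s₂, L₂ s ≤ energyDensityTT' t s U₂ n₂)
    (hF₁ : ∀ s ∈ Icc s₁ s₂, ∀ U ∈ Icc U₁ U₂, F₁ s ≤ energyDensityTT' t s U n₁)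
    (hπ₁ : ∀ s ∈ Icc s₁ s₂, ∀ U ∈ Icc U₁ U₂, pressureTT' βh₁ t s U n₁ ≤ Q₁ s)
    (hπ₂ : ∀ s ∈ Icc s₁ s₂, ∀ U ∈ Icc U₁ U₂, pressureTT' βh₂ t s U n₂ ≤ Q₂ s)
    (hk : 4 / Real.pi * ∑ b, |tz b| ≤ k)
    (hm₁ : ∀ s ∈ Icc s₁ s₂, 0 ≤ a * F₁ s + b * L₁ s - (c₀ + cs * s + c₁ * U₁) - k)
    (hm₂ : ∀ s ∈ Icc s₁ s₂, 0 ≤ a * F₁ s + b * L₂ s - (c₀ + cs * s + c₁ * U₂) - k)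
    (hg₁ : ∀ s ∈ Icc s₁ s₂, a * Q₁ s + b * Q₂ s + βh₁ * (a * F₁ s) + βh₂ * (b * L₁ s) <
      β₀ * (a * F₁ s + b * L₁ s - (c₀ + cs * s + c₁ * U₁) - k))
    (hg₂ : ∀ s ∈ Icc s₁ s₂, a * Q₁ s + b * Q₂ s + βh₁ * (a * F₁ s) + βh₂ * (b * L₂ s) <
      β₀ * (a * F₁ s + b * L₂ s - (c₀ + cs * s + c₁ * U₂) - k))
    {s : ℝ} (hs : s ∈ Icc (-s₂) (-s₁)) {U : ℝ} (hU : U ∈ Icc U₁ U₂)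
    {ω₁ ω₂ : InfVolFermionState 3} (h₁ : ω₁.IsTranslationInvariant) (h₂ : ω₂.IsTranslationInvariant)
    (hρ₁ : 0 < ω₁.density) (hρ₁' : ω₁.density ≤ 2 - n₂) (hρ₂ : 2 - n₁ ≤ ω₂.density) (hρ₂' : ω₂.density < 2)
    {lam : ℝ} (hl0 : 0 < lam) (hl1 : lam < 1) :
    (mix lam hl0.le hl1.le ω₁ ω₂).entropyDensitySup -
        β * (mix lam hl0.le hl1.le ω₁ ω₂).meanEnergy (layeredHubbardTTPrime t s U w tz) R' <
      (layeredHubbardTTPrime t s U w tz).varPressureAt β R' (mix lam hl0.le hl1.le ω₁ ω₂).density := by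
  have hn2' : 0 ≤ n₂ := hn₁.le.trans hn.le
  have hm0 : 0 < a * n₁ + b * n₂ := by nlinarith
  have hm2 : a * n₁ + b * n₂ < 2 := by nlinarith
  have hβpos : 0 < β := hβ₀pos.trans_le hβ₀
  have hs' : -s ∈ Icc s₁ s₂ := neg_mem_Icc_of_mem_Icc_neg hs
  have hUU : 0 ≤ U := hU₁.trans hU.1
  have hcap : energyDensityTT' t s U (b * (2 - n₂) + a * (2 - n₁)) ≤
      c₀ + cs * (-s) + c₁ * U + U * (b * (2 - n₂) + a * (2 - n₁) - 1) :=
    reflected_cap t hU₁ hab hm0 hm2 (C := fun s U => c₀ + cs * s + c₁ * U) hC s hs U hU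
  have hfl₂ : ((U₂ - U) * L₁ (-s) + (U - U₁) * L₂ (-s)) / (U₂ - U₁) + U * (1 - n₂) ≤ energyDensityTT' t s U (2 - n₂) :=
    reflected_floor t hU₁ (hn₁.trans hn) hn₂ (F := fun s U => ((U₂ - U) * L₁ s + (U - U₁) * L₂ s) / (U₂ - U₁))
      (floor_on_cell_of_columnLaws t hn2' hn₂ hU₁ h12 hL₁ hL₂) s hs U hU
  have hfl₁ : F₁ (-s) + U * (1 - n₁) ≤ energyDensityTT' t s U (2 - n₁) :=
    reflected_floor t hU₁ hn₁ (hn.trans hn₂) (F := fun s _ => F₁ s) hF₁ s hs U hU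
  have han₂ : pressureTT' βh₂ t s U (2 - n₂) ≤ Q₂ (-s) + βh₂ * U * (n₂ - 1) :=
    reflected_anchor t hβh₂ hU₁ (hn₁.trans hn) hn₂ (P := fun s _ => Q₂ s) hπ₂ s hs U hU
  have han₁ : pressureTT' βh₁ t s U (2 - n₁) ≤ Q₁ (-s) + βh₁ * U * (n₁ - 1) :=
    reflected_anchor t hβh₁ hU₁ hn₁ (hn.trans hn₂) (P := fun s _ => Q₁ s) hπ₁ s hs U hU
  obtain ⟨hMnn, hM₀⟩ := hotAnchor_chord_slack (c₀ := c₀ + cs * (-s)) (βh₁ := βh₁) (βh₂ := βh₂) (π₁ := Q₁ (-s))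
    (π₂ := Q₂ (-s)) h12 hU (hm₁ (-s) hs') (hm₂ (-s) hs') (hg₁ (-s) hs') (hg₂ (-s) hs')
  refine h₁.sub_mul_layered_lt_varPressureAt_mix_of_hotAnchors_of_threshold_of_cost_le t s hUU hβpos hw tz hR' hwR' h₂ hρ₁ hρ₂'
    hρ₁' (by linarith) hρ₂ hb ha (by linarith) hcap hfl₂ hfl₁ hβh₂ hβh₁ h0₂ h0₁ hβ₀ han₂ han₁ hk ?_ ?_ hl0 hl1
  · have hb1 : b = 1 - a := by linarith
    subst hb1
    linarith
  · have hb1 : b = 1 - a := by linarith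
    subst hb1
    linarith

end Summit.Ventures.CertifiedManyBodySolver.Observables

end
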